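/-
Copyright (c) 2026 the pub-hodgecm-mathlib formalisation cell (harness21).  Prover seat hodgecm-mathlib-K2Liu-p25 (g0), Track B «K2-LIT» ∕ hLiu418
#184♮ = `stmt-HodgeConjecture-24832`, Road Φ ∕ socket #41, organ G5-a (Φ7-2), face (β0) ∕ (u-0c) I1 (K2E5-plan (g7) TABLE #7 2026-09-04T16:11:39Z bracket
«(u-0c) I1 → K2Liu-p25»; K2E5-p16 (g7) hand-back census `CENSUS-u0c-I1-InnerFamily.K2E5-p16-g7.md`; K2Liu-p02 (g7) recipe `CENSUS-u0c-MiddleTermPackageInstance` §3).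
THEOREMS ONLY.
-/
import Summits.HodgeConjecture.HodgeConjecture.Theorems.K2LiuUnipDeltaCornerUnfoldC           -- ★ C-part p861167: `inner_section_unfold`, `reflStd_conj_mem_and_siegelDeltaCharacter_eq_one`
import Summits.HodgeConjecture.HodgeConjecture.Theorems.K2LiuCornerTorusAction                -- ★ p860212: `exists_corner_zero_torus∕upper_inv_conj_eq_mul`, `integral_comp_smul_eq_distribHaarChar_inv_smul`
import Summits.HodgeConjecture.HodgeConjecture.Theorems.K2LiuReflStdTorusConjDetDelta         -- ★ p861658: `detDelta_reflStd_conj_torus` (+ ★ p861617 `detDelta_reflStd_conj_levi`)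
import Summits.HodgeConjecture.HodgeConjecture.Theorems.K2LiuSiegelMiddleStabilizerCharacter  -- ★ `siegelDeltaCharacter_eq_one_of_detDelta_eq_one`
import Summits.HodgeConjecture.HodgeConjecture.Theorems.K2LiuMiddleInnerSectionBorelLaw       -- ★ (β0-1b) p859905: `inner_law_of_unfold`, `untwist_torus_law`, `untwist_unipotent_law`, `cpow_shift_half`
import Summits.HodgeConjecture.HodgeConjecture.Theorems.K2LiuSiegelWeylCharacterLaw           -- ★ `ofReal_inv_cpow`
import Literature.NumberTheory.Automorphic.IdeleModuleProofs                                  -- ★ Tate `AdeleRing.distribHaarChar_eq_ideleNorm`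
import Literature.NumberTheory.AdelicBaseChange.IdeleNormModule                               -- ★ `ideleNorm_ideleBaseChange`
import Literature.NumberTheory.Automorphic.GodementHeightFloor                                -- ★ `ideleNorm_unitsMap_adeleConj`
import Literature.NumberTheory.Automorphic.AdelicUnitaryGroupDatum                             -- ★ `conjAdele_complexConj`
import Literature.NumberTheory.Automorphic.IdeleClassGroup                                     -- ★ `coe_ideleNorm`
import Literature.NumberTheory.Automorphic.AdelicSecondCountable                               -- ★ `secondCountableTopology_adeleRing`
import Literature.NumberTheory.Automorphic.AdicCompletionCompact                               -- ★ `locallyCompactSpace_adeleRing'`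
import HarnessLib

/-!
# Crux `HLiu418`, Road Φ, organ G5-a, face (β0) ∕ (u-0c) I1: THE UNTWISTED INNER FAMILY OF THE MIDDLE TERM — the `GL₂(𝔸_L)` Borel laws `hφT` (flat torus law
# `(s+½, −(s+½))`) and `hφN` (unipotent invariance) of `φ s x g = ξ(det g)⁻¹ · b x · F_s(Λ g · k_x)`, DISCHARGED at the datum of #41

Cell `hodgecm-mathlib`, crux item hLiu418 = `stmt-HodgeConjecture-24832`; squad K2 ∕ K2Liu; prover K2Liu-p25 (g0).  THEOREMS ONLY (no `def`, no instance, no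
notation, no `sorry`); lane `--supports stmt-HodgeConjecture-24832 --as helper`.

WHY.  ★ (β0-4)′ `K2LiuMiddleCellPackageOfFacesGrowth.exists_middle_package_of_faces'` and ★ (u-0c) I3 `K2LiuSiegelMiddleTermKTypes.exists_KTypes_package` consume an
«untwisted inner family» `φ s x g = a g · b x · F s (Λ g · k_x)` (`a = ξ(det ·)⁻¹`) through exactly two laws: the FLAT torus law `hφT : φ s x (diag(d) · g) =
|d₀|^{s+½} |d₁|^{−(s+½)} φ s x g` and the unipotent invariance `hφN` (`0 < re s`).  THIS FILE proves both for the inner section `F_s(y) = c_s · ∫ f_s(w₀ · n₂(t) · y) dμ(t)`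
of the middle cell (★ C-part `inner_section_unfold`'s `hunfold`; `f_s ∈ I(s, χ)`, `w₀ = ι(1, g₀ ⊗ 1)`, `n₂` the corner line, `Λ : GL₂(𝔸_L) →* H(𝔸)` the chart's Levi):
* §1 the scalar `((√r : ℝ) : ℂ) ^ z = (r : ℂ) ^ (z ∕ 2)`; the inverse of an upper unitriangular `2 × 2` matrix.
* §2 ABSTRACT (any group `H`, `Λ : GL₂(𝔸_L) →* H`): **`phi_torus_law_of_inner_law`** — the `Λ`-torus law of `F` in the `χ`-form `F s (Λ(diag d) · y) =
  χ(d₀ d̄₁⁻¹) · |d₀|^{s+1} |d₁|^{−s} · F s y`, `hχc : χ(d̄) χ(d) = 1` (χ trivial on norms — conjugate-symplectic type) and `hξ : ξ(d) = χ(d) |d|^{½}` give `hφT` VERBATIM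
  (★ `untwist_torus_law`, ★ `cpow_shift_half`); **`phi_unipotent_law_of_inner_law`** — the `Λ`-unipotent invariance of `F` gives `hφN` VERBATIM (★ `untwist_unipotent_law`).
* §3 THE DATUM (`n = 2`, `w₀ = ι(1, g₀ ⊗ 1)`, `hΛ` the Levi frame): **`inner_section_unipotent_law`** `F(Λ u · y) = F(y)` (★ `inner_law_of_unfold_of_sigma_eq_one`; `hconj`
  ★ `exists_corner_zero_upper_inv_conj_eq_mul`, `hZ` ★ C-part `reflStd_conj_mem_and_siegelDeltaCharacter_eq_one`, `hP` ★ `isSiegelDelta_reflStd_conj_levi_unip_iff`, `σ = 1` ★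
  `detDelta_reflStd_conj_levi` + ★ `siegelDeltaCharacter_eq_one_of_detDelta_eq_one`); **`inner_section_torus_law`** `F(Λ(diag d) · y) = χ(d₀ d̄₁⁻¹) |d₀|^{s+1} |d₁|^{−s} F(y)`
  (★ `inner_law_of_unfold`; `hconj` ★ `exists_corner_zero_torus_inv_conj_eq_mul`, `act t = t · n`, `n ⊗ 1 = Nm(d₁)⁻¹` ★ `exists_unit_baseChange_eq_norm_inv`; `hscale` ★
  `integral_comp_smul_eq_distribHaarChar_inv_smul`, `m = Δ(n)⁻¹ = |d₁|_L` by ★ Tate `AdeleRing.distribHaarChar_eq_ideleNorm`, ★ `ideleNorm_ideleBaseChange`, ★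
  `ideleNorm_unitsMap_adeleConj`; `σ`-value ★ `detDelta_reflStd_conj_torus` `det_Δ = d₀ d̄₁⁻¹`, `modDelta = √|det_Δ|`).
* §4 ASSEMBLED for families: **`innerFamily_torus_law`** = `hφT` and **`innerFamily_unipotent_law`** = `hφN`, from `hf : ∀ s, f s ∈ I(s, χ)`, `hunfold`, `hχc`, `hξ`, `ha`, `hφ` only.
References: [MoeglinWaldspurger1995, II.1.7]; [KudlaRallis1994, §2 (2.10)–(2.12)]; [GelbartPiatetskishapiroRallis1987, Part A §§1–2]; [Tan1999, §1]; [TateThesis1967, Lemma 4.1.2];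
[Bump1997, §3.7].
HONEST LABEL.  Count-neutral helper: `HC_CM` is proved only modulo the 7 printed citations (2 remaining named inputs: hLiu418 = `stmt-HodgeConjecture-24832`,
h413 = `stmt-HodgeConjecture-24833`) until rung 0 closes; closes no socket by itself.
-/

set_option autoImplicit false
set_option linter.dupNamespace false -- the mandated namespace repeats `HodgeConjecture.HodgeConjecture`

noncomputable section

open scoped Matrix ENNReal NNReal
open NumberField IsDedekindDomain MeasureTheory MeasureTheory.Measure
open Literature.NumberTheory.Automorphic Literature.NumberTheory.Automorphic.UnitaryGroup Literature.NumberTheory.GaloisRepresentations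
open Literature.NumberTheory.GelbartRogawski1991 Literature.NumberTheory.GelbartRogawski1991.GRConstruction
open Literature.NumberTheory.K2Lit.SiegelDoubled Literature.MeasureTheory.Group
open Literature.NumberTheory.GelbartRogawski1991.AdaptedBlocks
open UnitaryDualPair
open Summit.HodgeConjecture.HodgeConjecture.Cruxes.HLiu418.K2LiuSiegelMiddleCellLeviCriterion (reflStd_inv isSiegelDelta_reflStd_conj_levi_unip_iff)
open Summit.HodgeConjecture.HodgeConjecture.Cruxes.HLiu418.K2LiuUnipDeltaCornerCoordinates (exists_gramRA_eq_diagonal)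
open Summit.HodgeConjecture.HodgeConjecture.Cruxes.HLiu418.K2LiuUnipDeltaCornerUnfoldC (reflStd_conj_mem_and_siegelDeltaCharacter_eq_one)
open Summit.HodgeConjecture.HodgeConjecture.Cruxes.HLiu418.K2LiuCornerTorusAction (exists_unit_baseChange_eq_norm_inv integral_comp_smul_eq_distribHaarChar_inv_smul
  exists_corner_zero_torus_inv_conj_eq_mul exists_corner_zero_upper_inv_conj_eq_mul)
open Summit.HodgeConjecture.HodgeConjecture.Cruxes.HLiu418.K2LiuReflStdLeviConjDeltaBlock (detDelta_reflStd_conj_levi)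
open Summit.HodgeConjecture.HodgeConjecture.Cruxes.HLiu418.K2LiuReflStdTorusConjDetDelta (detDelta_reflStd_conj_torus isUnit_detDelta_reflStd_conj_torus
  inv_mul_transpose_map_inv_mul_of_diagonal)
open Summit.HodgeConjecture.HodgeConjecture.Cruxes.HLiu418.K2LiuSiegelMiddleStabilizerCharacter (siegelDeltaCharacter_eq_one_of_detDelta_eq_one)
open Summit.HodgeConjecture.HodgeConjecture.Cruxes.HLiu418.K2LiuSiegelWeylCharacterLaw (ofReal_inv_cpow)
open Summit.HodgeConjecture.HodgeConjecture.Cruxes.HLiu418.K2LiuMiddleInnerSectionBorelLaw (inner_law_of_unfold inner_law_of_unfold_of_sigma_eq_one untwist_torus_law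
  untwist_unipotent_law cpow_shift_half ideleNorm_coe_pos)

namespace Summit.HodgeConjecture.HodgeConjecture.Cruxes.HLiu418.K2LiuSiegelMiddleTermInnerFamily

/-! ## §1 Scalar bookkeeping -/

section Scalar

/-- `((√r : ℝ) : ℂ) ^ z = (r : ℂ) ^ (z ∕ 2)` for `0 < r` (principal powers of positive reals). [folklore] -/
theorem ofReal_sqrt_cpow {r : ℝ} (hr : 0 < r) (z : ℂ) : ((Real.sqrt r : ℝ) : ℂ) ^ z = (r : ℂ) ^ (z / 2) := by
  have h1 : ((Real.sqrt r : ℝ) : ℂ) ≠ 0 := Complex.ofReal_ne_zero.2 (Real.sqrt_pos.2 hr).ne'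
  have h2 : (r : ℂ) ≠ 0 := Complex.ofReal_ne_zero.2 hr.ne'
  rw [Complex.cpow_def_of_ne_zero h1, Complex.cpow_def_of_ne_zero h2, ← Complex.ofReal_log (Real.sqrt_nonneg r), ← Complex.ofReal_log hr.le,
    Real.log_sqrt hr.le]
  congr 1
  push_cast
  ring

variable {R : Type*} [CommRing R]

/-- for an upper unitriangular `u ∈ GL₂(R)`: `(u⁻¹)₁₀ = 0` and `(u⁻¹)₁₁ = 1` (row `1` of `u · u⁻¹ = 1`). [folklore] -/
theorem inv_apply_one_of_unipotent {u : GL (Fin 2) R} (hu10 : (u : Matrix (Fin 2) (Fin 2) R) 1 0 = 0) (hu11 : (u : Matrix (Fin 2) (Fin 2) R) 1 1 = 1) :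
    ((u⁻¹ : GL (Fin 2) R) : Matrix (Fin 2) (Fin 2) R) 1 0 = 0 ∧ ((u⁻¹ : GL (Fin 2) R) : Matrix (Fin 2) (Fin 2) R) 1 1 = 1 := by
  have h : ∀ j, ((u : Matrix (Fin 2) (Fin 2) R) * ((u⁻¹ : GL (Fin 2) R) : Matrix (Fin 2) (Fin 2) R)) 1 j = (1 : Matrix (Fin 2) (Fin 2) R) 1 j := fun j => by
    rw [← Units.val_mul, mul_inv_cancel, Units.val_one]
  have h0 := h 0
  have h1 := h 1
  rw [Matrix.mul_apply, Fin.sum_univ_two, hu10, hu11, zero_mul, one_mul, zero_add] at h0 h1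
  exact ⟨h0.trans (Matrix.one_apply_ne one_ne_zero), h1.trans (Matrix.one_apply_eq 1)⟩

end Scalar

/-! ## §2 Abstract: `hφT` ∕ `hφN` from the `Λ`-laws of `F` -/

section Abstract

variable {L : Type} [Field L] [NumberField L] [IsCMField L]
variable {X H : Type*} [Group H]

/-- **`hφT` FROM THE `Λ`-TORUS LAW OF `F` IN THE `χ`-FORM.**  If `F s (Λ(diag d) · y) = χ(d₀ d̄₁⁻¹) · |d₀|^{s+1} |d₁|^{−s} · F s y` (`0 < re s`), `χ(d̄) χ(d) = 1` and
`ξ(d) = χ(d) |d|^{½}`, then `φ s x g = ξ(det g)⁻¹ · b x · F s (Λ g · k_x)` has the FLAT torus law of ★ (β0-4)′ (`hφT` VERBATIM).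
[cite: MoeglinWaldspurger1995, II.1.7] [cite: Bump1997, §3.7] -/
theorem phi_torus_law_of_inner_law (χ : HeckeCharacter L) (ξ : (AdeleRing (𝓞 L) L)ˣ →* ℂˣ)
    (hξ : ∀ d : (AdeleRing (𝓞 L) L)ˣ, ((ξ d : ℂˣ) : ℂ) = ((χ d : ℂˣ) : ℂ) * ((IdeleClassGroup.ideleNorm L d : ℝ) : ℂ) ^ (1 / 2 : ℂ))
    (hχc : ∀ d : (AdeleRing (𝓞 L) L)ˣ, χ (Units.map (conjAdele (Fp L) L (IsCMField.complexConj L) : AdeleRing (𝓞 L) L →* AdeleRing (𝓞 L) L) d) * χ d = 1)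
    (F : ℂ → H → ℂ) (Λ : GL (Fin 2) (AdeleRing (𝓞 L) L) →* H) (a : GL (Fin 2) (AdeleRing (𝓞 L) L) → ℂ)
    (ha : ∀ g, a g = (((ξ (Matrix.GeneralLinearGroup.det g))⁻¹ : ℂˣ) : ℂ)) (b : X → ℂ) (kx : X → H)
    (φ : ℂ → X → GL (Fin 2) (AdeleRing (𝓞 L) L) → ℂ) (hφ : ∀ s x g, φ s x g = a g * b x * F s (Λ g * kx x))
    (hFT : ∀ s : ℂ, 0 < s.re → ∀ (d : Fin 2 → (AdeleRing (𝓞 L) L)ˣ) (y : H),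
      F s (Λ (glDiagonal 2 (AdeleRing (𝓞 L) L) d) * y) =
        ((χ (d 0 * Units.map (conjAdele (Fp L) L (IsCMField.complexConj L) : AdeleRing (𝓞 L) L →* AdeleRing (𝓞 L) L) (d 1)⁻¹) : ℂˣ) : ℂ) *
          (((IdeleClassGroup.ideleNorm L (d 0) : ℝ) : ℂ) ^ (s + 1) * ((IdeleClassGroup.ideleNorm L (d 1) : ℝ) : ℂ) ^ (-s)) * F s y) :
    ∀ (s : ℂ) (x : X), 0 < s.re → ∀ (d : Fin 2 → (AdeleRing (𝓞 L) L)ˣ) (g : GL (Fin 2) (AdeleRing (𝓞 L) L)),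
      φ s x (glDiagonal 2 (AdeleRing (𝓞 L) L) d * g) =
        ((IdeleClassGroup.ideleNorm L (d 0) : ℝ) : ℂ) ^ (s + 1 / 2) * ((IdeleClassGroup.ideleNorm L (d 1) : ℝ) : ℂ) ^ (-(s + 1 / 2)) * φ s x g := by
  intro s x hs d g
  refine untwist_torus_law ξ s (fun g => b x * F s (Λ g * kx x)) (φ s x) (fun g => by rw [hφ, ha, mul_assoc]) (fun d g => ?_) d g
  -- the torus law of `φ₀ g := b x · F s (Λ g · k_x)` in the `ξ`-form
  have hχ1 : ((χ (d 0 * Units.map (conjAdele (Fp L) L (IsCMField.complexConj L) : AdeleRing (𝓞 L) L →* AdeleRing (𝓞 L) L) (d 1)⁻¹) : ℂˣ) : ℂ) =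
      ((χ (d 0) : ℂˣ) : ℂ) * ((χ (d 1) : ℂˣ) : ℂ) := by
    have h1 : χ (Units.map (conjAdele (Fp L) L (IsCMField.complexConj L) : AdeleRing (𝓞 L) L →* AdeleRing (𝓞 L) L) (d 1)⁻¹) = χ (d 1) := by
      rw [map_inv, map_inv]
      exact inv_eq_of_mul_eq_one_right (hχc (d 1))
    rw [map_mul, h1, Units.val_mul]
  have key : ((χ (d 0 * Units.map (conjAdele (Fp L) L (IsCMField.complexConj L) : AdeleRing (𝓞 L) L →* AdeleRing (𝓞 L) L) (d 1)⁻¹) : ℂˣ) : ℂ) *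
      (((IdeleClassGroup.ideleNorm L (d 0) : ℝ) : ℂ) ^ (s + 1) * ((IdeleClassGroup.ideleNorm L (d 1) : ℝ) : ℂ) ^ (-s)) =
      ((ξ (d 0) * ξ (d 1) : ℂˣ) : ℂ) *
        (((IdeleClassGroup.ideleNorm L (d 0) : ℝ) : ℂ) ^ (s + 1 / 2) * ((IdeleClassGroup.ideleNorm L (d 1) : ℝ) : ℂ) ^ (-(s + 1 / 2))) := by
    rw [hχ1, cpow_shift_half (ideleNorm_coe_pos (d 0)) (ideleNorm_coe_pos (d 1)) s, Units.val_mul, hξ, hξ]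
    ring
  rw [map_mul, mul_assoc (Λ (glDiagonal 2 (AdeleRing (𝓞 L) L) d)), hFT s hs d, ← key]
  ring

omit [IsCMField L] in
/-- **`hφN` FROM THE `Λ`-UNIPOTENT INVARIANCE OF `F`.**  If `F s (Λ u · y) = F s y` for upper unitriangular `u` (`0 < re s`), then `φ s x g = ξ(det g)⁻¹ · b x · F s (Λ g · k_x)`
is left-invariant under them (★ (β0-4)′ `hφN` VERBATIM; `det u = 1`). [cite: MoeglinWaldspurger1995, II.1.7] [cite: Bump1997, §3.7] -/
theorem phi_unipotent_law_of_inner_law (ξ : (AdeleRing (𝓞 L) L)ˣ →* ℂˣ)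
    (F : ℂ → H → ℂ) (Λ : GL (Fin 2) (AdeleRing (𝓞 L) L) →* H) (a : GL (Fin 2) (AdeleRing (𝓞 L) L) → ℂ)
    (ha : ∀ g, a g = (((ξ (Matrix.GeneralLinearGroup.det g))⁻¹ : ℂˣ) : ℂ)) (b : X → ℂ) (kx : X → H)
    (φ : ℂ → X → GL (Fin 2) (AdeleRing (𝓞 L) L) → ℂ) (hφ : ∀ s x g, φ s x g = a g * b x * F s (Λ g * kx x))
    (hFN : ∀ s : ℂ, 0 < s.re → ∀ (u : GL (Fin 2) (AdeleRing (𝓞 L) L)) (y : H), (u : Matrix (Fin 2) (Fin 2) (AdeleRing (𝓞 L) L)) 1 0 = 0 →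
      (u : Matrix (Fin 2) (Fin 2) (AdeleRing (𝓞 L) L)) 0 0 = 1 → (u : Matrix (Fin 2) (Fin 2) (AdeleRing (𝓞 L) L)) 1 1 = 1 → F s (Λ u * y) = F s y) :
    ∀ (s : ℂ) (x : X), 0 < s.re → ∀ u g : GL (Fin 2) (AdeleRing (𝓞 L) L), (u : Matrix (Fin 2) (Fin 2) (AdeleRing (𝓞 L) L)) 1 0 = 0 →
      (u : Matrix (Fin 2) (Fin 2) (AdeleRing (𝓞 L) L)) 0 0 = 1 → (u : Matrix (Fin 2) (Fin 2) (AdeleRing (𝓞 L) L)) 1 1 = 1 → φ s x (u * g) = φ s x g := by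
  intro s x hs u g hu10 hu00 hu11
  refine untwist_unipotent_law ξ (fun g => b x * F s (Λ g * kx x)) (φ s x) (fun g => by rw [hφ, ha, mul_assoc]) (fun u g hu10 hu00 hu11 => ?_) u g hu10 hu00 hu11
  rw [map_mul, mul_assoc (Λ u), hFN s hs u _ hu10 hu00 hu11]

end Abstract

/-! ## §3 The datum of #41 (`n = 2`, `w₀ = ι(1, g₀ ⊗ 1)`): the `Λ`-laws of the inner section `F(y) = c · ∫ f(w₀ · n₂(t) · y) dμ(t)` -/

section Datum

variable (L : Type) [Field L] [NumberField L] [IsCMField L]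
variable {N M : ℕ} (e : Fin N × Fin M ≃ Fin 2)
  (dV : Fin N → L) (hdV : ∀ i, IsCMField.complexConj L (dV i) = dV i)
  (dW : Fin M → L) (hdW : ∀ i, IsCMField.complexConj L (dW i) = dW i)
variable {g₀ : UnitaryGroup.rationalPair (Fp L) L (IsCMField.complexConj L) N M (Matrix.diagonal dV) (Matrix.diagonal dW)}
  (hg₀ : ((g₀ : GL (Fin N × Fin M) L) : Matrix (Fin N × Fin M) (Fin N × Fin M) L) = Matrix.diagonal (fun k => 1 - 2 * (![0, 1] : Fin 2 → L) (e k)))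
variable (Λ : GL (Fin 2) (AdeleRing (𝓞 L) L) →* HA L e dV hdV dW hdW)
  (hΛ : ∀ g : GL (Fin 2) (AdeleRing (𝓞 L) L), blk L e dV hdV dW hdW (Λ g) =
    cayR (AdeleRing (𝓞 L) L) (Fin 2) * Matrix.fromBlocks (g : Matrix (Fin 2) (Fin 2) (AdeleRing (𝓞 L) L)) 0 0
      (((gramR L e dV hdV dW hdW).map ((algebraMap L (AdeleRing (𝓞 L) L)).comp (algebraMap (Fp L) L)))⁻¹ *
        (((g⁻¹ : GL (Fin 2) (AdeleRing (𝓞 L) L)) : Matrix (Fin 2) (Fin 2) (AdeleRing (𝓞 L) L)).map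
          (conjAdele (Fp L) L (IsCMField.complexConj L)))ᵀ *
        (gramR L e dV hdV dW hdW).map ((algebraMap L (AdeleRing (𝓞 L) L)).comp (algebraMap (Fp L) L))) *
      cayRinv (AdeleRing (𝓞 L) L) (Fin 2))

/-- the `♯`-co-block `x♯ = T⁻¹ (x̄⁻¹)ᵀ T` of an upper unitriangular `u ∈ GL₂(𝔸_L)` has `(u♯)₀₁ = 0` and `(u♯)₁₁ = 1` (`T = T_𝔸` diagonal with unit entries,
★ `exists_gramRA_eq_diagonal`). [cite: MoeglinWaldspurger1995, II.1.7] [cite: KudlaRallis1994, §2] -/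
theorem sharp_apply_of_unipotent (hdV0 : ∀ i, dV i ≠ 0) (hdW0 : ∀ i, dW i ≠ 0) (u : GL (Fin 2) (AdeleRing (𝓞 L) L))
    (hu10 : (u : Matrix (Fin 2) (Fin 2) (AdeleRing (𝓞 L) L)) 1 0 = 0) (hu11 : (u : Matrix (Fin 2) (Fin 2) (AdeleRing (𝓞 L) L)) 1 1 = 1) :
    (((gramR L e dV hdV dW hdW).map ((algebraMap L (AdeleRing (𝓞 L) L)).comp (algebraMap (Fp L) L)))⁻¹ *
          ((((u)⁻¹ : GL (Fin 2) (AdeleRing (𝓞 L) L)) : Matrix (Fin 2) (Fin 2) (AdeleRing (𝓞 L) L)).map (conjAdele (Fp L) L (IsCMField.complexConj L)))ᵀ *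
          (gramR L e dV hdV dW hdW).map ((algebraMap L (AdeleRing (𝓞 L) L)).comp (algebraMap (Fp L) L))) 0 1 = 0 ∧
      (((gramR L e dV hdV dW hdW).map ((algebraMap L (AdeleRing (𝓞 L) L)).comp (algebraMap (Fp L) L)))⁻¹ *
          ((((u)⁻¹ : GL (Fin 2) (AdeleRing (𝓞 L) L)) : Matrix (Fin 2) (Fin 2) (AdeleRing (𝓞 L) L)).map (conjAdele (Fp L) L (IsCMField.complexConj L)))ᵀ *
          (gramR L e dV hdV dW hdW).map ((algebraMap L (AdeleRing (𝓞 L) L)).comp (algebraMap (Fp L) L))) 1 1 = 1 := by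
  obtain ⟨t, ht0, hT⟩ := exists_gramRA_eq_diagonal L e dV hdV dW hdW hdV0 hdW0
  have htu : ∀ i, IsUnit (((algebraMap L (AdeleRing (𝓞 L) L)).comp (algebraMap (Fp L) L)) (t i)) := fun i => (IsUnit.mk0 _ (ht0 i)).map _
  have hTinv : ((gramR L e dV hdV dW hdW).map ((algebraMap L (AdeleRing (𝓞 L) L)).comp (algebraMap (Fp L) L)))⁻¹ =
      Matrix.diagonal fun i => Ring.inverse (((algebraMap L (AdeleRing (𝓞 L) L)).comp (algebraMap (Fp L) L)) (t i)) := by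
    rw [hT]
    refine Matrix.inv_eq_left_inv ?_
    rw [Matrix.diagonal_mul_diagonal, ← Matrix.diagonal_one]
    congr 1
    funext i
    exact Ring.inverse_mul_cancel _ (htu i)
  obtain ⟨hi10, hi11⟩ := inv_apply_one_of_unipotent hu10 hu11
  rw [hTinv, hT, Matrix.mul_diagonal, Matrix.diagonal_mul, Matrix.transpose_apply, Matrix.map_apply, hi10, map_zero, mul_zero, zero_mul,
    Matrix.mul_diagonal, Matrix.diagonal_mul, Matrix.transpose_apply, Matrix.map_apply, hi11, map_one, mul_one, Ring.inverse_mul_cancel _ (htu 1)]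
  exact ⟨rfl, rfl⟩

include hg₀ hΛ in
/-- **`w₀ · Λ(u) · w₀ ∈ P_Δ(𝔸)` and `σ_{χ,s}(w₀ Λ(u) w₀) = 1` for upper unitriangular `u`** (★ `isSiegelDelta_reflStd_conj_levi_unip_iff` at `u_N = 1`; `det_Δ = 1` by
★ `detDelta_reflStd_conj_levi`, then ★ `siegelDeltaCharacter_eq_one_of_detDelta_eq_one`). [cite: MoeglinWaldspurger1995, II.1.7] [cite: Tan1999, §1] -/
theorem reflStd_conj_levi_unipotent (hdV0 : ∀ i, dV i ≠ 0) (hdW0 : ∀ i, dW i ≠ 0) (χ : HeckeCharacter L) (s : ℂ) (u : GL (Fin 2) (AdeleRing (𝓞 L) L))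
    (hu10 : (u : Matrix (Fin 2) (Fin 2) (AdeleRing (𝓞 L) L)) 1 0 = 0) (hu00 : (u : Matrix (Fin 2) (Fin 2) (AdeleRing (𝓞 L) L)) 0 0 = 1)
    (hu11 : (u : Matrix (Fin 2) (Fin 2) (AdeleRing (𝓞 L) L)) 1 1 = 1) :
    IsSiegelDelta L e dV hdV dW hdW (iotaGG L e dV hdV dW hdW (1, UnitaryGroup.rationalPairToAdelic (Fp L) L (IsCMField.complexConj L) N M (Matrix.diagonal dV) (Matrix.diagonal dW) g₀) * Λ u * iotaGG L e dV hdV dW hdW (1, UnitaryGroup.rationalPairToAdelic (Fp L) L (IsCMField.complexConj L) N M (Matrix.diagonal dV) (Matrix.diagonal dW) g₀)) ∧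
      siegelDeltaCharacter L e dV hdV dW hdW χ s (iotaGG L e dV hdV dW hdW (1, UnitaryGroup.rationalPairToAdelic (Fp L) L (IsCMField.complexConj L) N M (Matrix.diagonal dV) (Matrix.diagonal dW) g₀) * Λ u * iotaGG L e dV hdV dW hdW (1, UnitaryGroup.rationalPairToAdelic (Fp L) L (IsCMField.complexConj L) N M (Matrix.diagonal dV) (Matrix.diagonal dW) g₀)) = 1 := by
  obtain ⟨h01, h11⟩ := sharp_apply_of_unipotent L e dV hdV dW hdW hdV0 hdW0 u hu10 hu11
  have h := isSiegelDelta_reflStd_conj_levi_unip_iff L e dV hdV dW hdW hg₀ Λ hΛ u (one_mem (unipDelta L e dV hdV dW hdW))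
  rw [mul_one, blk_one, ← Matrix.fromBlocks_one, Matrix.toBlocks_fromBlocks₁₂, Matrix.mul_zero, Matrix.zero_apply] at h
  refine ⟨h.2 ⟨⟨hu10, h01⟩, rfl⟩, siegelDeltaCharacter_eq_one_of_detDelta_eq_one L e dV hdV dW hdW χ s ?_⟩
  rw [detDelta_reflStd_conj_levi L e dV hdV dW hdW hg₀ Λ hΛ u, hu00, hu10, h01, h11]
  ring

include hg₀ hΛ in
/-- **THE `Λ`-UNIPOTENT INVARIANCE OF THE INNER SECTION**: for `F(y) = c · ∫ f(w₀ · n₂(t) · y) dμ(t)` with `f ∈ I(s, χ)` and upper unitriangular `u ∈ GL₂(𝔸_L)`,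
**`F(Λ(u) · y) = F(y)`** (★ `inner_law_of_unfold_of_sigma_eq_one`: `hconj` ★ `exists_corner_zero_upper_inv_conj_eq_mul` (`act = id`), `hZ` ★ C-part
`reflStd_conj_mem_and_siegelDeltaCharacter_eq_one`, `hP` ∕ `σ = 1` by `reflStd_conj_levi_unipotent`). [cite: MoeglinWaldspurger1995, II.1.7] [cite: KudlaRallis1994, §2 (2.10)–(2.12)] -/
theorem inner_section_unipotent_law (hdV0 : ∀ i, dV i ≠ 0) (hdW0 : ∀ i, dW i ≠ 0)
    [MeasurableSpace (AdeleRing (𝓞 (Fp L)) (Fp L))] (μ : Measure (AdeleRing (𝓞 (Fp L)) (Fp L)))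
    (n₂ : AdeleRing (𝓞 (Fp L)) (Fp L) → HA L e dV hdV dW hdW) (hn₂mem : ∀ t, n₂ t ∈ unipDelta L e dV hdV dW hdW)
    (hn₂X : ∀ t, (blk L e dV hdV dW hdW (n₂ t)).toBlocks₁₂ =
      Matrix.single (1 : Fin 2) (1 : Fin 2) (Literature.NumberTheory.Automorphic.AdeleRing.baseChange (Fp L) L t * algebraMap L (AdeleRing (𝓞 L) L) (imagUnit L)))
    (χ : HeckeCharacter L) (s : ℂ) (f : HA L e dV hdV dW hdW → ℂ) (hf : IsSiegelDeltaSection L e dV hdV dW hdW χ s f) (F : HA L e dV hdV dW hdW → ℂ) (c : ℂ)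
    (hunfold : ∀ y, F y = c * ∫ t, f (iotaGG L e dV hdV dW hdW (1, UnitaryGroup.rationalPairToAdelic (Fp L) L (IsCMField.complexConj L) N M (Matrix.diagonal dV) (Matrix.diagonal dW) g₀) * n₂ t * y) ∂μ)
    (u : GL (Fin 2) (AdeleRing (𝓞 L) L)) (hu10 : (u : Matrix (Fin 2) (Fin 2) (AdeleRing (𝓞 L) L)) 1 0 = 0)
    (hu00 : (u : Matrix (Fin 2) (Fin 2) (AdeleRing (𝓞 L) L)) 0 0 = 1) (hu11 : (u : Matrix (Fin 2) (Fin 2) (AdeleRing (𝓞 L) L)) 1 1 = 1)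
    (y : HA L e dV hdV dW hdW) : F (Λ u * y) = F y := by
  obtain ⟨hP, hσ⟩ := reflStd_conj_levi_unipotent L e dV hdV dW hdW hg₀ Λ hΛ hdV0 hdW0 χ s u hu10 hu00 hu11
  refine inner_law_of_unfold_of_sigma_eq_one μ Λ (iotaGG L e dV hdV dW hdW (1, UnitaryGroup.rationalPairToAdelic (Fp L) L (IsCMField.complexConj L) N M (Matrix.diagonal dV) (Matrix.diagonal dW) g₀)) n₂ f F c hunfold (siegelDeltaCharacter L e dV hdV dW hdW χ s)
    {p | IsSiegelDelta L e dV hdV dW hdW p} (fun p hp h => hf p hp h)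
    {z : HA L e dV hdV dW hdW | z ∈ unipDelta L e dV hdV dW hdW ∧ (blk L e dV hdV dW hdW z).toBlocks₁₂ 1 1 = 0}
    (reflStd_conj_mem_and_siegelDeltaCharacter_eq_one L e dV hdV dW hdW hg₀ Λ hΛ χ s) u id (fun t => ?_) (fun _ => rfl) ?_ ?_ y
  · obtain ⟨z, hz, hz11, heq⟩ := exists_corner_zero_upper_inv_conj_eq_mul L e dV hdV dW hdW Λ hΛ hdV0 hdW0 u hu10 hu00 hu11 n₂ hn₂mem hn₂X t
    exact ⟨z, ⟨hz, hz11⟩, heq⟩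
  · rw [reflStd_inv L e dV hdV dW hdW hg₀]
    exact hP
  · rw [reflStd_inv L e dV hdV dW hdW hg₀]
    exact hσ

include hg₀ hΛ in
/-- **`w₀ · Λ(diag d) · w₀ ∈ P_Δ(𝔸)` and the `σ`-VALUE `σ_{χ,s}(w₀ Λ(diag(d₀,d₁)) w₀) = χ(d₀ d̄₁⁻¹) · |d₀|^{s+1} |d₁|^{−(s+1)}`** (`n = 2`: ★ `detDelta_reflStd_conj_torus`
`det_Δ = d₀ d̄₁⁻¹`, `modDelta = √|det_Δ|_𝔸`, `|d̄|_𝔸 = |d|_𝔸` ★ `ideleNorm_unitsMap_adeleConj`; membership ★ `isSiegelDelta_reflStd_conj_levi_unip_iff` at `u_N = 1`, the `♯`-block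
of `diag d` being diagonal ★ `inv_mul_transpose_map_inv_mul_of_diagonal`). [cite: MoeglinWaldspurger1995, II.1.7] [cite: KudlaRallis1994, §2 (2.10)–(2.12)] [cite: Tan1999, §1] -/
theorem reflStd_conj_levi_torus (hdV0 : ∀ i, dV i ≠ 0) (hdW0 : ∀ i, dW i ≠ 0) (χ : HeckeCharacter L) (s : ℂ) (d : Fin 2 → (AdeleRing (𝓞 L) L)ˣ) :
    IsSiegelDelta L e dV hdV dW hdW (iotaGG L e dV hdV dW hdW (1, UnitaryGroup.rationalPairToAdelic (Fp L) L (IsCMField.complexConj L) N M (Matrix.diagonal dV) (Matrix.diagonal dW) g₀) * Λ (glDiagonal 2 (AdeleRing (𝓞 L) L) d) * iotaGG L e dV hdV dW hdW (1, UnitaryGroup.rationalPairToAdelic (Fp L) L (IsCMField.complexConj L) N M (Matrix.diagonal dV) (Matrix.diagonal dW) g₀)) ∧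
      siegelDeltaCharacter L e dV hdV dW hdW χ s (iotaGG L e dV hdV dW hdW (1, UnitaryGroup.rationalPairToAdelic (Fp L) L (IsCMField.complexConj L) N M (Matrix.diagonal dV) (Matrix.diagonal dW) g₀) * Λ (glDiagonal 2 (AdeleRing (𝓞 L) L) d) * iotaGG L e dV hdV dW hdW (1, UnitaryGroup.rationalPairToAdelic (Fp L) L (IsCMField.complexConj L) N M (Matrix.diagonal dV) (Matrix.diagonal dW) g₀)) =
        ((χ (d 0 * Units.map (conjAdele (Fp L) L (IsCMField.complexConj L) : AdeleRing (𝓞 L) L →* AdeleRing (𝓞 L) L) (d 1)⁻¹) : ℂˣ) : ℂ) * (((IdeleClassGroup.ideleNorm L (d 0) : ℝ) : ℂ) ^ (s + 1) * ((IdeleClassGroup.ideleNorm L (d 1) : ℝ) : ℂ) ^ (-(s + 1))) := by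
  obtain ⟨t, ht0, hT⟩ := exists_gramRA_eq_diagonal L e dV hdV dW hdW hdV0 hdW0
  have htu : ∀ i, IsUnit (((algebraMap L (AdeleRing (𝓞 L) L)).comp (algebraMap (Fp L) L)) (t i)) := fun i => (IsUnit.mk0 _ (ht0 i)).map _
  have hx : ((glDiagonal 2 (AdeleRing (𝓞 L) L) d : GL (Fin 2) (AdeleRing (𝓞 L) L)) : Matrix (Fin 2) (Fin 2) (AdeleRing (𝓞 L) L)) =
      Matrix.diagonal fun i => (d i : AdeleRing (𝓞 L) L) := rfl
  -- membership
  have h := isSiegelDelta_reflStd_conj_levi_unip_iff L e dV hdV dW hdW hg₀ Λ hΛ (glDiagonal 2 (AdeleRing (𝓞 L) L) d) (one_mem (unipDelta L e dV hdV dW hdW))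
  rw [mul_one, blk_one, ← Matrix.fromBlocks_one, Matrix.toBlocks_fromBlocks₁₂, Matrix.mul_zero, Matrix.zero_apply] at h
  have h10 : ((glDiagonal 2 (AdeleRing (𝓞 L) L) d : GL (Fin 2) (AdeleRing (𝓞 L) L)) : Matrix (Fin 2) (Fin 2) (AdeleRing (𝓞 L) L)) 1 0 = 0 := by
    rw [hx, Matrix.diagonal_apply_ne _ (by decide)]
  have h01 : ((((gramR L e dV hdV dW hdW).map ((algebraMap L (AdeleRing (𝓞 L) L)).comp (algebraMap (Fp L) L)))⁻¹ *
          ((((glDiagonal 2 (AdeleRing (𝓞 L) L) d)⁻¹ : GL (Fin 2) (AdeleRing (𝓞 L) L)) : Matrix (Fin 2) (Fin 2) (AdeleRing (𝓞 L) L)).map (conjAdele (Fp L) L (IsCMField.complexConj L)))ᵀ *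
          (gramR L e dV hdV dW hdW).map ((algebraMap L (AdeleRing (𝓞 L) L)).comp (algebraMap (Fp L) L)))) 0 1 = 0 := by
    rw [inv_mul_transpose_map_inv_mul_of_diagonal (conjAdele (Fp L) L (IsCMField.complexConj L)) d _ hx _ _ hT htu, Matrix.diagonal_apply_ne _ (by decide)]
  refine ⟨h.2 ⟨⟨h10, h01⟩, rfl⟩, ?_⟩
  -- the `σ`-value
  have hu : IsUnit (detDelta L e dV hdV dW hdW (iotaGG L e dV hdV dW hdW (1, UnitaryGroup.rationalPairToAdelic (Fp L) L (IsCMField.complexConj L) N M (Matrix.diagonal dV) (Matrix.diagonal dW) g₀) * Λ (glDiagonal 2 (AdeleRing (𝓞 L) L) d) * iotaGG L e dV hdV dW hdW (1, UnitaryGroup.rationalPairToAdelic (Fp L) L (IsCMField.complexConj L) N M (Matrix.diagonal dV) (Matrix.diagonal dW) g₀))) :=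
    isUnit_detDelta_reflStd_conj_torus L e dV hdV dW hdW hg₀ Λ hΛ d _ hx _ hT htu
  have hunit : hu.unit = d 0 * Units.map (conjAdele (Fp L) L (IsCMField.complexConj L) : AdeleRing (𝓞 L) L →* AdeleRing (𝓞 L) L) (d 1)⁻¹ := Units.ext (by
    rw [IsUnit.unit_spec, detDelta_reflStd_conj_torus L e dV hdV dW hdW hg₀ Λ hΛ d _ hx _ hT htu, Units.val_mul, Units.coe_map, MonoidHom.coe_coe])
  have hN0 := ideleNorm_coe_pos (d 0)
  have hN1 := ideleNorm_coe_pos (d 1)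
  have hnorm : Literature.NumberTheory.GaloisRepresentations.ideleNorm (d 0 * Units.map (conjAdele (Fp L) L (IsCMField.complexConj L) : AdeleRing (𝓞 L) L →* AdeleRing (𝓞 L) L) (d 1)⁻¹) =
      (IdeleClassGroup.ideleNorm L (d 0) : ℝ) * ((IdeleClassGroup.ideleNorm L (d 1) : ℝ))⁻¹ := by
    rw [← coe_ideleNorm, map_mul, conjAdele_complexConj, Godement.ideleNorm_unitsMap_adeleConj, map_inv, NNReal.coe_mul, NNReal.coe_inv]
  unfold siegelDeltaCharacter chiDet modDelta
  rw [dif_pos hu, dif_pos hu, hunit, hnorm, ofReal_sqrt_cpow (mul_pos hN0 (inv_pos.2 hN1)), Complex.ofReal_mul,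
    Complex.mul_cpow_ofReal_nonneg hN0.le (inv_pos.2 hN1).le, ofReal_inv_cpow hN1,
    show (2 * s + ((2 : ℕ) : ℂ)) / 2 = s + 1 by push_cast; ring]

include hg₀ hΛ in
/-- **THE `Λ`-TORUS LAW OF THE INNER SECTION**: for `F(y) = c · ∫ f(w₀ · n₂(t) · y) dμ(t)` (`μ` an additive Haar measure on `𝔸_{L⁺}`, `f ∈ I(s, χ)`) and `d = (d₀, d₁)`,
**`F(Λ(diag d) · y) = χ(d₀ d̄₁⁻¹) · |d₀|^{s+1} |d₁|^{−s} · F(y)`** (★ `inner_law_of_unfold`: `hconj` ★ `exists_corner_zero_torus_inv_conj_eq_mul` with `act t = t · n`,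
`n ⊗ 1 = Nm(d₁)⁻¹` ★ `exists_unit_baseChange_eq_norm_inv`; `hscale` ★ `integral_comp_smul_eq_distribHaarChar_inv_smul` with `m = Δ(n)⁻¹ = |d₁|_L` — ★ Tate
`AdeleRing.distribHaarChar_eq_ideleNorm`, ★ `ideleNorm_ideleBaseChange` (`[L : L⁺] = 2`), ★ `ideleNorm_unitsMap_adeleConj`; `hZ` ★ C-part; `hP` and the `σ`-value by
`reflStd_conj_levi_torus`). [cite: MoeglinWaldspurger1995, II.1.7] [cite: KudlaRallis1994, §2 (2.10)–(2.12)] [cite: TateThesis1967, Lemma 4.1.2] -/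
theorem inner_section_torus_law (hdV0 : ∀ i, dV i ≠ 0) (hdW0 : ∀ i, dW i ≠ 0)
    [MeasurableSpace (AdeleRing (𝓞 (Fp L)) (Fp L))] [BorelSpace (AdeleRing (𝓞 (Fp L)) (Fp L))]
    (μ : Measure (AdeleRing (𝓞 (Fp L)) (Fp L))) [μ.IsAddHaarMeasure]
    (n₂ : AdeleRing (𝓞 (Fp L)) (Fp L) → HA L e dV hdV dW hdW) (hn₂mem : ∀ t, n₂ t ∈ unipDelta L e dV hdV dW hdW)
    (hn₂X : ∀ t, (blk L e dV hdV dW hdW (n₂ t)).toBlocks₁₂ =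
      Matrix.single (1 : Fin 2) (1 : Fin 2) (Literature.NumberTheory.Automorphic.AdeleRing.baseChange (Fp L) L t * algebraMap L (AdeleRing (𝓞 L) L) (imagUnit L)))
    (χ : HeckeCharacter L) (s : ℂ) (f : HA L e dV hdV dW hdW → ℂ) (hf : IsSiegelDeltaSection L e dV hdV dW hdW χ s f) (F : HA L e dV hdV dW hdW → ℂ) (c : ℂ)
    (hunfold : ∀ y, F y = c * ∫ t, f (iotaGG L e dV hdV dW hdW (1, UnitaryGroup.rationalPairToAdelic (Fp L) L (IsCMField.complexConj L) N M (Matrix.diagonal dV) (Matrix.diagonal dW) g₀) * n₂ t * y) ∂μ)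
    (d : Fin 2 → (AdeleRing (𝓞 L) L)ˣ) (y : HA L e dV hdV dW hdW) :
    F (Λ (glDiagonal 2 (AdeleRing (𝓞 L) L) d) * y) = ((χ (d 0 * Units.map (conjAdele (Fp L) L (IsCMField.complexConj L) : AdeleRing (𝓞 L) L →* AdeleRing (𝓞 L) L) (d 1)⁻¹) : ℂˣ) : ℂ) * (((IdeleClassGroup.ideleNorm L (d 0) : ℝ) : ℂ) ^ (s + 1) * ((IdeleClassGroup.ideleNorm L (d 1) : ℝ) : ℂ) ^ (-s)) * F y := by
  haveI : LocallyCompactSpace (AdeleRing (𝓞 (Fp L)) (Fp L)) := locallyCompactSpace_adeleRing' (Fp L)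
  haveI : SecondCountableTopology (AdeleRing (𝓞 (Fp L)) (Fp L)) := secondCountableTopology_adeleRing (Fp L)
  haveI : μ.Regular := by infer_instance
  obtain ⟨hP, hσ⟩ := reflStd_conj_levi_torus L e dV hdV dW hdW hg₀ Λ hΛ hdV0 hdW0 χ s d
  obtain ⟨n, hn⟩ := exists_unit_baseChange_eq_norm_inv L (d 1)
  have hx : ((glDiagonal 2 (AdeleRing (𝓞 L) L) d : GL (Fin 2) (AdeleRing (𝓞 L) L)) : Matrix (Fin 2) (Fin 2) (AdeleRing (𝓞 L) L)) =
      Matrix.diagonal fun i => (d i : AdeleRing (𝓞 L) L) := rfl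
  have hN1 := ideleNorm_coe_pos (d 1)
  -- `|n|_{L⁺} = |d₁|_L⁻¹`
  have hn' : Literature.NumberTheory.Automorphic.AdeleRing.ideleBaseChange (Fp L) L n = (d 1)⁻¹ * Units.map (conjAdele (Fp L) L (IsCMField.complexConj L) : AdeleRing (𝓞 L) L →* AdeleRing (𝓞 L) L) (d 1)⁻¹ :=
    Units.ext (by rw [AdeleRing.coe_ideleBaseChange, hn, Units.val_mul, Units.coe_map, MonoidHom.coe_coe])
  have hnn : IdeleClassGroup.ideleNorm (Fp L) n = (IdeleClassGroup.ideleNorm L (d 1))⁻¹ := by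
    have h2 := Literature.NumberTheory.AdelicBaseChange.ideleNorm_ideleBaseChange (K := Fp L) (L := L) n
    rw [hn', map_mul, conjAdele_complexConj, Godement.ideleNorm_unitsMap_adeleConj, map_inv, Algebra.IsQuadraticExtension.finrank_eq_two] at h2
    have h3 := congrArg NNReal.sqrt h2
    rw [NNReal.sqrt_mul_self, NNReal.sqrt_sq] at h3
    exact h3.symm
  -- `hscale`: `∫ φ (t · n) dμ(t) = |d₁|_L · ∫ φ dμ`
  have hscale : ∀ φ' : AdeleRing (𝓞 (Fp L)) (Fp L) → ℂ, ∫ t, φ' (t * n) ∂μ = ((IdeleClassGroup.ideleNorm L (d 1) : ℝ) : ℂ) * ∫ t, φ' t ∂μ := fun φ' => by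
    have h := integral_comp_smul_eq_distribHaarChar_inv_smul μ n φ'
    have h' : (fun t => φ' (t * (n : AdeleRing (𝓞 (Fp L)) (Fp L)))) = fun t => φ' (n • t) :=
      funext fun t => by rw [Units.smul_def, smul_eq_mul, mul_comm]
    rw [h', h, NNReal.smul_def, Complex.real_smul, AdeleRing.distribHaarChar_eq_ideleNorm, hnn, inv_inv]
  have key : F (Λ (glDiagonal 2 (AdeleRing (𝓞 L) L) d) * y) =
      ((IdeleClassGroup.ideleNorm L (d 1) : ℝ) : ℂ) * siegelDeltaCharacter L e dV hdV dW hdW χ s (iotaGG L e dV hdV dW hdW (1, UnitaryGroup.rationalPairToAdelic (Fp L) L (IsCMField.complexConj L) N M (Matrix.diagonal dV) (Matrix.diagonal dW) g₀) * Λ (glDiagonal 2 (AdeleRing (𝓞 L) L) d) * (iotaGG L e dV hdV dW hdW (1, UnitaryGroup.rationalPairToAdelic (Fp L) L (IsCMField.complexConj L) N M (Matrix.diagonal dV) (Matrix.diagonal dW) g₀))⁻¹) * F y :=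
    inner_law_of_unfold μ Λ (iotaGG L e dV hdV dW hdW (1, UnitaryGroup.rationalPairToAdelic (Fp L) L (IsCMField.complexConj L) N M (Matrix.diagonal dV) (Matrix.diagonal dW) g₀)) n₂ f F c hunfold (siegelDeltaCharacter L e dV hdV dW hdW χ s)
      {p | IsSiegelDelta L e dV hdV dW hdW p} (fun p hp h => hf p hp h)
      {z : HA L e dV hdV dW hdW | z ∈ unipDelta L e dV hdV dW hdW ∧ (blk L e dV hdV dW hdW z).toBlocks₁₂ 1 1 = 0}
      (reflStd_conj_mem_and_siegelDeltaCharacter_eq_one L e dV hdV dW hdW hg₀ Λ hΛ χ s) (glDiagonal 2 (AdeleRing (𝓞 L) L) d)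
      (fun t => t * n) ((IdeleClassGroup.ideleNorm L (d 1) : ℝ) : ℂ)
      (fun t => by
        obtain ⟨z, hz, hz11, heq⟩ := exists_corner_zero_torus_inv_conj_eq_mul L e dV hdV dW hdW Λ hΛ hdV0 hdW0 d _ hx n hn n₂ hn₂mem hn₂X t
        exact ⟨z, ⟨hz, hz11⟩, heq⟩)
      hscale (by rw [reflStd_inv L e dV hdV dW hdW hg₀]; exact hP) y
  -- `|d₁| · |d₁|^{−(s+1)} = |d₁|^{−s}` (★ `Literature.NumberTheory.LFunctions.PiOmega.ofReal_mul_cpow_neg_add_one`, inlined to keep the import cone automorphic)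
  have hshift : ((IdeleClassGroup.ideleNorm L (d 1) : ℝ) : ℂ) * ((IdeleClassGroup.ideleNorm L (d 1) : ℝ) : ℂ) ^ (-(s + 1)) = ((IdeleClassGroup.ideleNorm L (d 1) : ℝ) : ℂ) ^ (-s) := by
    rw [show ((IdeleClassGroup.ideleNorm L (d 1) : ℝ) : ℂ) * ((IdeleClassGroup.ideleNorm L (d 1) : ℝ) : ℂ) ^ (-(s + 1)) = ((IdeleClassGroup.ideleNorm L (d 1) : ℝ) : ℂ) ^ (1 : ℂ) * ((IdeleClassGroup.ideleNorm L (d 1) : ℝ) : ℂ) ^ (-(s + 1)) by rw [Complex.cpow_one],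
      ← Complex.cpow_add _ _ (Complex.ofReal_ne_zero.2 hN1.ne')]
    congr 1
    ring
  rw [key, reflStd_inv L e dV hdV dW hdW hg₀, hσ, ← hshift]
  ring

/-! ## §4 Assembled for families: `hφT` and `hφN` of ★ (β0-4)′ `exists_middle_package_of_faces'` ∕ ★ (u-0c) I3 `exists_KTypes_package` -/

include hg₀ hΛ in
/-- **(u-0c) I1 — `hφN` OF THE UNTWISTED INNER FAMILY, DISCHARGED.**  For Siegel sections `f_s ∈ I(s, χ)`, the inner sections `F_s(y) = c_s · ∫ f_s(w₀ · n₂(t) · y) dμ(t)` of the middle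
cell (★ C-part `inner_section_unfold`'s `hunfold`) and `φ s x g = a g · b x · F_s(Λ g · k_x)` with `a = ξ(det ·)⁻¹`: **`φ s x (u · g) = φ s x g`** for upper unitriangular `u`
(`0 < re s`) — the binder `hφN` of ★ `exists_middle_package_of_faces'` VERBATIM. [cite: MoeglinWaldspurger1995, II.1.7] [cite: KudlaRallis1994, §2 (2.10)–(2.12)] [cite: Bump1997, §3.7] -/
theorem innerFamily_unipotent_law (hdV0 : ∀ i, dV i ≠ 0) (hdW0 : ∀ i, dW i ≠ 0)
    [MeasurableSpace (AdeleRing (𝓞 (Fp L)) (Fp L))] (μ : Measure (AdeleRing (𝓞 (Fp L)) (Fp L)))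
    (n₂ : AdeleRing (𝓞 (Fp L)) (Fp L) → HA L e dV hdV dW hdW) (hn₂mem : ∀ t, n₂ t ∈ unipDelta L e dV hdV dW hdW)
    (hn₂X : ∀ t, (blk L e dV hdV dW hdW (n₂ t)).toBlocks₁₂ =
      Matrix.single (1 : Fin 2) (1 : Fin 2) (Literature.NumberTheory.Automorphic.AdeleRing.baseChange (Fp L) L t * algebraMap L (AdeleRing (𝓞 L) L) (imagUnit L)))
    (χ : HeckeCharacter L) (f : ℂ → HA L e dV hdV dW hdW → ℂ) (hf : ∀ s : ℂ, IsSiegelDeltaSection L e dV hdV dW hdW χ s (f s))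
    (F : ℂ → HA L e dV hdV dW hdW → ℂ) (c : ℂ → ℂ) (hunfold : ∀ (s : ℂ) (y : HA L e dV hdV dW hdW), F s y = c s * ∫ t, f s (iotaGG L e dV hdV dW hdW (1, UnitaryGroup.rationalPairToAdelic (Fp L) L (IsCMField.complexConj L) N M (Matrix.diagonal dV) (Matrix.diagonal dW) g₀) * n₂ t * y) ∂μ)
    {X : Type*} (ξ : (AdeleRing (𝓞 L) L)ˣ →* ℂˣ) (a : GL (Fin 2) (AdeleRing (𝓞 L) L) → ℂ) (ha : ∀ g, a g = (((ξ (Matrix.GeneralLinearGroup.det g))⁻¹ : ℂˣ) : ℂ))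
    (b : X → ℂ) (kx : X → HA L e dV hdV dW hdW) (φ : ℂ → X → GL (Fin 2) (AdeleRing (𝓞 L) L) → ℂ) (hφ : ∀ s x g, φ s x g = a g * b x * F s (Λ g * kx x)) :
    ∀ (s : ℂ) (x : X), 0 < s.re → ∀ u g : GL (Fin 2) (AdeleRing (𝓞 L) L), (u : Matrix (Fin 2) (Fin 2) (AdeleRing (𝓞 L) L)) 1 0 = 0 →
      (u : Matrix (Fin 2) (Fin 2) (AdeleRing (𝓞 L) L)) 0 0 = 1 → (u : Matrix (Fin 2) (Fin 2) (AdeleRing (𝓞 L) L)) 1 1 = 1 → φ s x (u * g) = φ s x g :=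
  phi_unipotent_law_of_inner_law ξ F Λ a ha b kx φ hφ fun s _ u y hu10 hu00 hu11 =>
    inner_section_unipotent_law L e dV hdV dW hdW hg₀ Λ hΛ hdV0 hdW0 μ n₂ hn₂mem hn₂X χ s (f s) (hf s) (F s) (c s) (hunfold s) u hu10 hu00 hu11 y

include hg₀ hΛ in
/-- **(u-0c) I1 — `hφT` OF THE UNTWISTED INNER FAMILY, DISCHARGED.**  Same data, `μ` an additive Haar measure on `𝔸_{L⁺}`, `χ` trivial on norms (`hχc : χ(d̄) χ(d) = 1` — the
conjugate-symplectic type of the doubling character) and `ξ = χ · |·|^{½}` (`hξ`): **`φ s x (diag(d) · g) = |d₀|^{s+½} |d₁|^{−(s+½)} φ s x g`** (`0 < re s`) — the binder `hφT` of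
★ `exists_middle_package_of_faces'` VERBATIM (§3 `inner_section_torus_law` + §2 `phi_torus_law_of_inner_law`). [cite: MoeglinWaldspurger1995, II.1.7] [cite: KudlaRallis1994, §2 (2.10)–(2.12)]
[cite: TateThesis1967, Lemma 4.1.2] [cite: Bump1997, §3.7] -/
theorem innerFamily_torus_law (hdV0 : ∀ i, dV i ≠ 0) (hdW0 : ∀ i, dW i ≠ 0)
    [MeasurableSpace (AdeleRing (𝓞 (Fp L)) (Fp L))] [BorelSpace (AdeleRing (𝓞 (Fp L)) (Fp L))]
    (μ : Measure (AdeleRing (𝓞 (Fp L)) (Fp L))) [μ.IsAddHaarMeasure]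
    (n₂ : AdeleRing (𝓞 (Fp L)) (Fp L) → HA L e dV hdV dW hdW) (hn₂mem : ∀ t, n₂ t ∈ unipDelta L e dV hdV dW hdW)
    (hn₂X : ∀ t, (blk L e dV hdV dW hdW (n₂ t)).toBlocks₁₂ =
      Matrix.single (1 : Fin 2) (1 : Fin 2) (Literature.NumberTheory.Automorphic.AdeleRing.baseChange (Fp L) L t * algebraMap L (AdeleRing (𝓞 L) L) (imagUnit L)))
    (χ : HeckeCharacter L) (hχc : ∀ d : (AdeleRing (𝓞 L) L)ˣ, χ (Units.map (conjAdele (Fp L) L (IsCMField.complexConj L) : AdeleRing (𝓞 L) L →* AdeleRing (𝓞 L) L) d) * χ d = 1)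
    (f : ℂ → HA L e dV hdV dW hdW → ℂ) (hf : ∀ s : ℂ, IsSiegelDeltaSection L e dV hdV dW hdW χ s (f s))
    (F : ℂ → HA L e dV hdV dW hdW → ℂ) (c : ℂ → ℂ) (hunfold : ∀ (s : ℂ) (y : HA L e dV hdV dW hdW), F s y = c s * ∫ t, f s (iotaGG L e dV hdV dW hdW (1, UnitaryGroup.rationalPairToAdelic (Fp L) L (IsCMField.complexConj L) N M (Matrix.diagonal dV) (Matrix.diagonal dW) g₀) * n₂ t * y) ∂μ)
    {X : Type*} (ξ : (AdeleRing (𝓞 L) L)ˣ →* ℂˣ)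
    (hξ : ∀ d : (AdeleRing (𝓞 L) L)ˣ, ((ξ d : ℂˣ) : ℂ) = ((χ d : ℂˣ) : ℂ) * ((IdeleClassGroup.ideleNorm L d : ℝ) : ℂ) ^ (1 / 2 : ℂ))
    (a : GL (Fin 2) (AdeleRing (𝓞 L) L) → ℂ) (ha : ∀ g, a g = (((ξ (Matrix.GeneralLinearGroup.det g))⁻¹ : ℂˣ) : ℂ))
    (b : X → ℂ) (kx : X → HA L e dV hdV dW hdW) (φ : ℂ → X → GL (Fin 2) (AdeleRing (𝓞 L) L) → ℂ) (hφ : ∀ s x g, φ s x g = a g * b x * F s (Λ g * kx x)) :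
    ∀ (s : ℂ) (x : X), 0 < s.re → ∀ (d : Fin 2 → (AdeleRing (𝓞 L) L)ˣ) (g : GL (Fin 2) (AdeleRing (𝓞 L) L)),
      φ s x (glDiagonal 2 (AdeleRing (𝓞 L) L) d * g) =
        ((IdeleClassGroup.ideleNorm L (d 0) : ℝ) : ℂ) ^ (s + 1 / 2) * ((IdeleClassGroup.ideleNorm L (d 1) : ℝ) : ℂ) ^ (-(s + 1 / 2)) * φ s x g :=
  phi_torus_law_of_inner_law χ ξ hξ hχc F Λ a ha b kx φ hφ fun s _ d y =>
    inner_section_torus_law L e dV hdV dW hdW hg₀ Λ hΛ hdV0 hdW0 μ n₂ hn₂mem hn₂X χ s (f s) (hf s) (F s) (c s) (hunfold s) d y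

end Datum

end Summit.HodgeConjecture.HodgeConjecture.Cruxes.HLiu418.K2LiuSiegelMiddleTermInnerFamily

end
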